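import Literature.NumberTheory.Transcendental.ThetaSubgroupTransport
import HarnessLib

/-!
# `exp⁻¹(G')` is `Θ`-definable for every connected algebraic subgroup `G'` of `M_κ`

Topic: `Literature/NumberTheory/Transcendental`. A brick of the discharge of the named fact
`Literature.NumberTheory.Transcendental.philippon1986_std` (classification of the obstruction
subgroups of Philippon's zero estimate on `M_κ = 𝔾ₘ^β × P_κ`, general number of elliptic factors):
the Euclidean reduction announced in `ThetaSubgroupTransport.lean`. For every datum
`K = (A, C, Ξ)` (`GaGmE.Std.SubgroupDataC`):

* `exists_split_step` — **Euclid**: if `e_b ∈ C` for `b ∈ S` and `c ∈ C` is a non-zero integer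
  vector vanishing on `S`, a chain of sign changes and transvections among the support of `c`
  (each a `Θ`-morphic isomorphism `M_κ ≅ M_{κ'}` carrying `exp⁻¹(G'_K)` onto `exp⁻¹(G'_{K'})`) leads
  to a datum with `e_b ∈ C'` for `b ∈ S ∪ {b₀}`, `b₀ ∉ S`, of the same rank, whose definability
  implies that of `exp⁻¹(G'_K)` (induction on `∑_b |c_b|`);
* `thetaDefinable_preimageSubgroup` — **`exp⁻¹(G') = Lie G' + ker(exp)` is the common zero set of a
  set of theta forms**, for EVERY `K` (induction on `dim C - |S|` down to the split case
  `C = span{e_b : b ∈ S}` of `ThetaSplitSubgroups.lean`);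
* `zeroSet_vanishing_tangent_subset_preimageSubgroup` — hence, in any theta model of `M_κ`, the
  closure `Z(𝔍(Lie G'))` of the Lie algebra of `G'` is contained in `exp⁻¹(G')` (the input "B3" of
  the classification of the closed irreducible subgroups).

Everything is PROVED; the only definitions are the integer-vector bookkeeping (`castQ`, `absSum`).

## References

* Yu. V. Nesterenko, P. Philippon (eds.), *Introduction to Algebraic Independence Theory*,
  LNM 1752, Springer 2001, Ch. 11 (D. Roy), Thm. 4.1. [NesterenkoPhilippon2001]
* D. Bertrand, P. Philippon, *Sous-groupes algébriques de groupes algébriques commutatifs*,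
  Illinois J. Math. 32 (1988), 263–280. [folklore]
-/

noncomputable section

open Complex MvPolynomial Module
open scoped PeriodPair

namespace Literature.NumberTheory.Transcendental

namespace GaGmE

namespace Std

variable {β γ δ : Type} [Fintype β] [Fintype γ] [Fintype δ] [DecidableEq γ]
variable (L : PeriodPair)

/-! ### Integer vectors -/

/-- An integer vector read in `ℚ^γ`. [folklore] -/
def castQ (c : γ → ℤ) : γ → ℚ := fun b => (c b : ℚ)

/-- The size `∑_b |c_b|` of an integer vector. [folklore] -/
def absSum (c : γ → ℤ) : ℕ := ∑ b, (c b).natAbs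

omit [Fintype β] [Fintype δ] [DecidableEq γ] in
/-- A vector of size `0` is `0`. [folklore] -/
theorem eq_zero_of_absSum_eq_zero {c : γ → ℤ} (h : absSum c = 0) : c = 0 := by
  funext b
  have := (Finset.sum_eq_zero_iff.mp h) b (Finset.mem_univ b)
  simpa using this

omit [Fintype β] [Fintype δ] in
/-- The size after replacing one entry. [folklore] -/
theorem absSum_update (c : γ → ℤ) (b₀ : γ) (v : ℤ) :
    absSum (Function.update c b₀ v) + (c b₀).natAbs = absSum c + v.natAbs := by
  unfold absSum
  rw [← Finset.add_sum_erase Finset.univ _ (Finset.mem_univ b₀),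
    ← Finset.add_sum_erase Finset.univ (fun b => (c b).natAbs) (Finset.mem_univ b₀), Function.update_self]
  have : ∑ x ∈ Finset.univ.erase b₀, (Function.update c b₀ v x).natAbs = ∑ x ∈ Finset.univ.erase b₀, (c x).natAbs :=
    Finset.sum_congr rfl fun x hx => by rw [Function.update_of_ne (Finset.ne_of_mem_erase hx)]
  rw [this]
  ring

omit [Fintype β] [Fintype δ] [DecidableEq γ] in
/-- **Clearing denominators**: every rational vector is an integer vector divided by an integer. [folklore] -/
theorem exists_int_multiple (v : γ → ℚ) : ∃ (d : ℤ) (c : γ → ℤ), d ≠ 0 ∧ ∀ b, (c b : ℚ) = d * v b := by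
  classical
  refine ⟨∏ b, ((v b).den : ℤ), fun b => (v b).num * ∏ b' ∈ Finset.univ.erase b, ((v b').den : ℤ),
    Finset.prod_ne_zero_iff.mpr fun b _ => by exact_mod_cast (v b).den_nz, fun b => ?_⟩
  have h := Rat.mul_den_eq_num (v b)
  push_cast
  rw [← Finset.mul_prod_erase Finset.univ (fun b' => ((v b').den : ℚ)) (Finset.mem_univ b)]
  linear_combination (-(∏ b' ∈ Finset.univ.erase b, ((v b').den : ℚ))) * h

/-! ### The coordinate vectors and the row operations -/

omit [Fintype β] [Fintype γ] [Fintype δ] in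
/-- The flip fixes `e_b` for `b ≠ b₀`. [folklore] -/
theorem flipRow_single_of_ne (R : Type*) [CommRing R] {b b₀ : γ} (h : b ≠ b₀) :
    flipRow R b₀ (Pi.single b (1 : R)) = Pi.single b 1 := by
  funext b'
  rw [flipRow_apply]
  by_cases hb' : b' = b₀
  · subst hb'; rw [if_pos rfl, Pi.single_eq_of_ne h.symm, neg_zero]
  · rw [if_neg hb']

omit [Fintype β] [Fintype γ] [Fintype δ] in
/-- The transvection fixes `e_b` for `b ∉ {b₁, b₂}`. [folklore] -/
theorem tvRow_single_of_ne (R : Type*) [CommRing R] {b b₁ b₂ : γ} (h12 : b₁ ≠ b₂) (h1 : b ≠ b₁) (h2 : b ≠ b₂) :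
    tvRow R b₁ b₂ h12 (Pi.single b (1 : R)) = Pi.single b 1 := by
  funext b'
  rw [tvRow_apply]
  by_cases hb' : b' = b₂
  · subst hb'; rw [if_pos rfl, Pi.single_eq_of_ne h2.symm, Pi.single_eq_of_ne h1.symm, sub_zero]
  · rw [if_neg hb']

omit [Fintype β] [Fintype γ] [Fintype δ] in
/-- `castQ` commutes with the flip. [folklore] -/
theorem castQ_flipRow (b₀ : γ) (c : γ → ℤ) : castQ (flipRow ℤ b₀ c) = flipRow ℚ b₀ (castQ c) := by
  unfold castQ; rw [flipRow_intCast]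

omit [Fintype β] [Fintype γ] [Fintype δ] in
/-- `castQ` commutes with the transvection. [folklore] -/
theorem castQ_tvRow {b₁ b₂ : γ} (h12 : b₁ ≠ b₂) (c : γ → ℤ) :
    castQ (tvRow ℤ b₁ b₂ h12 c) = tvRow ℚ b₁ b₂ h12 (castQ c) := by
  unfold castQ; rw [tvRow_intCast]

/-! ### One flip, one transvection -/

section Steps

variable (κM : δ → γ → Kbar) (K : SubgroupDataC β γ δ κM) (S : Finset γ) (c : γ → ℤ)

/-- **The flip step** with its invariants. [folklore] -/
theorem flip_step (b₂ : γ) (hb₂ : b₂ ∉ S) (hS : ∀ b ∈ S, Pi.single b (1 : ℚ) ∈ K.C) (hc : castQ c ∈ K.C) :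
    (∀ b ∈ S, Pi.single b (1 : ℚ) ∈ (flipData κM b₂ K).C) ∧
      castQ (flipRow ℤ b₂ c) ∈ (flipData κM b₂ K).C ∧
      finrank ℚ (flipData κM b₂ K).C = finrank ℚ K.C ∧
      (ThetaDefinable L (flipKappa κM b₂) (preimageSubgroup L (flipKappa κM b₂) (flipData κM b₂ K) : Set (β ⊕ (γ ⊕ δ) → ℂ)) →
        ThetaDefinable L κM (preimageSubgroup L κM K : Set (β ⊕ (γ ⊕ δ) → ℂ))) := by
  refine ⟨fun b hb => ?_, ?_, LinearEquiv.finrank_map_eq _ _, thetaDefinable_of_flip L κM b₂ K⟩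
  · have : Pi.single b (1 : ℚ) = flipRow ℚ b₂ (Pi.single b 1) :=
      (flipRow_single_of_ne ℚ (ne_of_mem_of_not_mem hb hb₂)).symm
    rw [this]
    exact Submodule.mem_map_of_mem (hS b hb)
  · rw [castQ_flipRow]
    exact Submodule.mem_map_of_mem hc

/-- **The transvection step** with its invariants. [folklore] -/
theorem tv_step {b₁ b₂ : γ} (h12 : b₁ ≠ b₂) (hb₁ : b₁ ∉ S) (hb₂ : b₂ ∉ S)
    (hS : ∀ b ∈ S, Pi.single b (1 : ℚ) ∈ K.C) (hc : castQ c ∈ K.C) :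
    (∀ b ∈ S, Pi.single b (1 : ℚ) ∈ (tvData κM h12 K).C) ∧
      castQ (tvRow ℤ b₁ b₂ h12 c) ∈ (tvData κM h12 K).C ∧
      finrank ℚ (tvData κM h12 K).C = finrank ℚ K.C ∧
      (ThetaDefinable L (tvKappa κM b₁ b₂) (preimageSubgroup L (tvKappa κM b₁ b₂) (tvData κM h12 K) : Set (β ⊕ (γ ⊕ δ) → ℂ)) →
        ThetaDefinable L κM (preimageSubgroup L κM K : Set (β ⊕ (γ ⊕ δ) → ℂ))) := by
  refine ⟨fun b hb => ?_, ?_, LinearEquiv.finrank_map_eq _ _, thetaDefinable_of_tv L κM h12 K⟩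
  · have : Pi.single b (1 : ℚ) = tvRow ℚ b₁ b₂ h12 (Pi.single b 1) :=
      (tvRow_single_of_ne ℚ h12 (ne_of_mem_of_not_mem hb hb₁) (ne_of_mem_of_not_mem hb hb₂)).symm
    rw [this]
    exact Submodule.mem_map_of_mem (hS b hb)
  · rw [castQ_tvRow]
    exact Submodule.mem_map_of_mem hc

end Steps

/-! ### Euclid -/

/-- **Euclidean reduction.** Given `e_b ∈ C` for `b ∈ S` and a non-zero integer vector `c ∈ C`
vanishing on `S`, a chain of flips and transvections among the support of `c` leads to a datum
`K'` over some `κ'` with `e_b ∈ C'` for `b ∈ S ∪ {b₀}`, `b₀ ∉ S`, `dim C' = dim C`, and such that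
the definability of `exp⁻¹(G'_{K'})` implies that of `exp⁻¹(G'_K)`. [folklore] -/
theorem exists_split_step (m : ℕ) :
    ∀ (κM : δ → γ → Kbar) (K : SubgroupDataC β γ δ κM) (S : Finset γ) (c : γ → ℤ),
      (∀ b ∈ S, Pi.single b (1 : ℚ) ∈ K.C) → castQ c ∈ K.C → (∀ b ∈ S, c b = 0) → c ≠ 0 → absSum c ≤ m →
      ∃ (κM' : δ → γ → Kbar) (K' : SubgroupDataC β γ δ κM') (b₀ : γ), b₀ ∉ S ∧
        (∀ b ∈ insert b₀ S, Pi.single b (1 : ℚ) ∈ K'.C) ∧ finrank ℚ K'.C = finrank ℚ K.C ∧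
        (ThetaDefinable L κM' (preimageSubgroup L κM' K' : Set (β ⊕ (γ ⊕ δ) → ℂ)) →
          ThetaDefinable L κM (preimageSubgroup L κM K : Set (β ⊕ (γ ⊕ δ) → ℂ))) := by
  induction m with
  | zero =>
    intro κM K S c _ _ _ hc0 hm
    exact absurd (eq_zero_of_absSum_eq_zero (Nat.le_zero.mp hm)) hc0
  | succ m ih =>
    intro κM K S c hS hc hcS hc0 hm
    classical
    -- a coordinate of maximal size
    set supp : Finset γ := Finset.univ.filter fun b => c b ≠ 0 with hsupp
    have hsupp_ne : supp.Nonempty := by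
      by_contra h
      rw [Finset.not_nonempty_iff_eq_empty] at h
      apply hc0
      funext b
      by_contra hb
      have : b ∈ supp := Finset.mem_filter.mpr ⟨Finset.mem_univ b, hb⟩
      rw [h] at this
      exact absurd this (Finset.notMem_empty b)
    obtain ⟨b₂, hb₂supp, hmax⟩ := Finset.exists_max_image supp (fun b => (c b).natAbs) hsupp_ne
    have hcb₂ : c b₂ ≠ 0 := (Finset.mem_filter.mp hb₂supp).2
    have hb₂S : b₂ ∉ S := fun h => hcb₂ (hcS b₂ h)
    by_cases hA : ∀ b, b ≠ b₂ → c b = 0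
    · -- the support is `{b₂}`: `e_{b₂} ∈ C` already
      refine ⟨κM, K, b₂, hb₂S, fun b hb => ?_, rfl, id⟩
      rcases Finset.mem_insert.mp hb with rfl | hb
      · have hce : castQ c = (c b : ℚ) • Pi.single b (1 : ℚ) := by
          funext b'
          by_cases hb' : b' = b
          · subst hb'; simp [castQ]
          · simp [castQ, Pi.single_eq_of_ne hb', hA b' hb']
        have hcb : (c b : ℚ) ≠ 0 := by exact_mod_cast hcb₂
        have := K.C.smul_mem (c b : ℚ)⁻¹ hc
        rwa [hce, smul_smul, inv_mul_cancel₀ hcb, one_smul] at this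
      · exact hS b hb
    · -- a second coordinate `b₁` in the support, `|c b₁| ≤ |c b₂|`
      simp only [not_forall] at hA
      obtain ⟨b₁, h12, hcb₁⟩ := hA
      have hb₁S : b₁ ∉ S := fun h => hcb₁ (hcS b₁ h)
      have hb₁supp : b₁ ∈ supp := Finset.mem_filter.mpr ⟨Finset.mem_univ _, hcb₁⟩
      have hle : (c b₁).natAbs ≤ (c b₂).natAbs := hmax b₁ hb₁supp
      -- after an optional flip at `b₂`, the two entries have the same sign; then transvect
      -- generic conclusion from a datum with the same-sign property
      have key : ∀ (κ₂ : δ → γ → Kbar) (K₂ : SubgroupDataC β γ δ κ₂) (c₂ : γ → ℤ),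
          (∀ b ∈ S, Pi.single b (1 : ℚ) ∈ K₂.C) → castQ c₂ ∈ K₂.C → (∀ b ∈ S, c₂ b = 0) →
          c₂ b₁ = c b₁ → (0 < c b₁ ∧ 0 < c₂ b₂ ∨ c b₁ < 0 ∧ c₂ b₂ < 0) → (c₂ b₂).natAbs = (c b₂).natAbs →
          absSum c₂ = absSum c →
          ∃ (κM' : δ → γ → Kbar) (K' : SubgroupDataC β γ δ κM') (b₀ : γ), b₀ ∉ S ∧
            (∀ b ∈ insert b₀ S, Pi.single b (1 : ℚ) ∈ K'.C) ∧ finrank ℚ K'.C = finrank ℚ K₂.C ∧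
            (ThetaDefinable L κM' (preimageSubgroup L κM' K' : Set (β ⊕ (γ ⊕ δ) → ℂ)) →
              ThetaDefinable L κ₂ (preimageSubgroup L κ₂ K₂ : Set (β ⊕ (γ ⊕ δ) → ℂ))) := by
        intro κ₂ K₂ c₂ hS₂ hc₂ hcS₂ h1 hsign h2abs hsum
        obtain ⟨hS₃, hc₃, hrk₃, htr₃⟩ := tv_step L κ₂ K₂ S c₂ h12 hb₁S hb₂S hS₂ hc₂
        set c₃ := tvRow ℤ b₁ b₂ h12 c₂ with hc₃def
        have hc₃b : ∀ b, c₃ b = if b = b₂ then c₂ b₂ - c₂ b₁ else c₂ b := fun b => tvRow_apply ℤ h12 c₂ b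
        have hcS₃ : ∀ b ∈ S, c₃ b = 0 := by
          intro b hb
          rw [hc₃b, if_neg (ne_of_mem_of_not_mem hb hb₂S)]
          exact hcS₂ b hb
        have hc₃0 : c₃ ≠ 0 := by
          intro h
          have := congrFun h b₁
          rw [hc₃b, if_neg h12, h1] at this
          exact hcb₁ this
        have hsize : absSum c₃ + (c b₁).natAbs = absSum c₂ := by
          have hupd : c₃ = Function.update c₂ b₂ (c₂ b₂ - c₂ b₁) := by
            funext b; rw [hc₃b]; by_cases hb : b = b₂
            · subst hb; simp
            · simp [hb]
          have h := absSum_update c₂ b₂ (c₂ b₂ - c₂ b₁)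
          rw [← hupd] at h
          have habs : (c₂ b₂ - c₂ b₁).natAbs + (c b₁).natAbs = (c₂ b₂).natAbs := by
            rw [h1]; rcases hsign with ⟨ha, hb⟩ | ⟨ha, hb⟩ <;> omega
          omega
        have hm₃ : absSum c₃ ≤ m := by
          have : 0 < (c b₁).natAbs := Int.natAbs_pos.mpr hcb₁
          omega
        obtain ⟨κ', K', b₀, hb₀, hS', hrk', htr'⟩ := ih _ _ S c₃ hS₃ hc₃ hcS₃ hc₃0 hm₃
        exact ⟨κ', K', b₀, hb₀, hS', hrk'.trans hrk₃, fun h => htr₃ (htr' h)⟩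
      by_cases hsign : 0 < c b₁ * c b₂
      · -- same sign: transvect directly
        have hs : 0 < c b₁ ∧ 0 < c b₂ ∨ c b₁ < 0 ∧ c b₂ < 0 := by
          rcases lt_trichotomy 0 (c b₁) with h | h | h
          · exact Or.inl ⟨h, pos_of_mul_pos_right hsign h.le⟩
          · exact absurd h.symm hcb₁
          · exact Or.inr ⟨h, neg_of_mul_pos_right hsign h.le⟩
        exact key κM K c hS hc hcS rfl hs rfl rfl
      · -- opposite signs: flip `b₂` first
        have hneg : c b₁ * c b₂ < 0 := lt_of_le_of_ne (not_lt.mp hsign) (mul_ne_zero hcb₁ hcb₂)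
        obtain ⟨hS₂, hc₂, hrk₂, htr₂⟩ := flip_step L κM K S c b₂ hb₂S hS hc
        set c₂ := flipRow ℤ b₂ c with hc₂def
        have hc₂b : ∀ b, c₂ b = if b = b₂ then -c b₂ else c b := fun b => flipRow_apply ℤ b₂ c b
        have hcS₂ : ∀ b ∈ S, c₂ b = 0 := by
          intro b hb
          rw [hc₂b, if_neg (ne_of_mem_of_not_mem hb hb₂S)]
          exact hcS b hb
        have h1 : c₂ b₁ = c b₁ := by rw [hc₂b, if_neg h12]
        have h2 : c₂ b₂ = -c b₂ := by rw [hc₂b, if_pos rfl]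
        have hs : 0 < c b₁ ∧ 0 < c₂ b₂ ∨ c b₁ < 0 ∧ c₂ b₂ < 0 := by
          rw [h2]
          rcases lt_trichotomy 0 (c b₁) with h | h | h
          · exact Or.inl ⟨h, by nlinarith [neg_of_mul_neg_right hneg h.le]⟩
          · exact absurd h.symm hcb₁
          · refine Or.inr ⟨h, ?_⟩
            have := pos_of_mul_neg_right hneg h.le
            linarith
        have h2abs : (c₂ b₂).natAbs = (c b₂).natAbs := by rw [h2, Int.natAbs_neg]
        have hsum : absSum c₂ = absSum c := by
          have hupd : c₂ = Function.update c b₂ (-c b₂) := by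
            funext b; rw [hc₂b]; by_cases hb : b = b₂
            · subst hb; simp
            · simp [hb]
          have h := absSum_update c b₂ (-c b₂)
          rw [← hupd, Int.natAbs_neg] at h
          omega
        obtain ⟨κ', K', b₀, hb₀, hS', hrk', htr'⟩ := key _ _ c₂ hS₂ hc₂ hcS₂ h1 hs h2abs hsum
        exact ⟨κ', K', b₀, hb₀, hS', hrk'.trans hrk₂, fun h => htr₂ (htr' h)⟩

/-! ### The coordinate span has the expected dimension -/

omit [Fintype β] [Fintype δ] in
/-- `dim coordSpan S = |S|`. [folklore] -/
theorem finrank_coordSpan (S : Finset γ) : finrank ℚ (coordSpan S) = S.card := by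
  classical
  have hli : LinearIndependent ℚ fun b : (S : Set γ) => (Pi.single (b : γ) (1 : ℚ) : γ → ℚ) := by
    have h := (Pi.basisFun ℚ γ).linearIndependent
    have h' : LinearIndependent ℚ fun b : γ => (Pi.single b (1 : ℚ) : γ → ℚ) := by
      convert h using 1
      funext b
      simp [Pi.basisFun_apply]
    exact h'.comp _ Subtype.val_injective
  have hspan : coordSpan S = Submodule.span ℚ (Set.range fun b : (S : Set γ) => (Pi.single (b : γ) (1 : ℚ) : γ → ℚ)) := by
    rw [coordSpan, Set.image_eq_range]
  rw [hspan, finrank_span_eq_card hli]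
  simp

/-! ### Definability for every datum -/

/-- Induction on `dim C - |S|`. [folklore] -/
theorem thetaDefinable_preimageSubgroup_aux (n : ℕ) :
    ∀ (κM : δ → γ → Kbar) (K : SubgroupDataC β γ δ κM) (S : Finset γ),
      (∀ b ∈ S, Pi.single b (1 : ℚ) ∈ K.C) → finrank ℚ K.C = S.card + n →
      ThetaDefinable L κM (preimageSubgroup L κM K : Set (β ⊕ (γ ⊕ δ) → ℂ)) := by
  induction n with
  | zero =>
    intro κM K S hS hrk
    have hle : coordSpan S ≤ K.C := Submodule.span_le.mpr (by rintro _ ⟨b, hb, rfl⟩; exact hS b hb)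
    have heq : coordSpan S = K.C :=
      Submodule.eq_of_le_of_finrank_eq hle (by rw [finrank_coordSpan, hrk, add_zero])
    exact thetaDefinable_preimageSubgroup_of_split L κM K S heq.symm
  | succ n ih =>
    intro κM K S hS hrk
    classical
    -- a vector of `C` outside the coordinate span, made to vanish on `S`, made integral
    have hnot : ¬ K.C ≤ coordSpan S := by
      intro hle
      have := Submodule.finrank_mono hle
      rw [finrank_coordSpan, hrk] at this
      omega
    obtain ⟨v, hvC, hvS⟩ := SetLike.not_le_iff_exists.mp hnot
    set v' : γ → ℚ := v - ∑ b ∈ S, v b • (Pi.single b (1 : ℚ) : γ → ℚ) with hv'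
    have hv'C : v' ∈ K.C := K.C.sub_mem hvC (Submodule.sum_mem _ fun b hb => Submodule.smul_mem _ _ (hS b hb))
    have hv'S : ∀ b ∈ S, v' b = 0 := by
      intro b hb
      simp only [hv', Pi.sub_apply, Finset.sum_apply, Pi.smul_apply, smul_eq_mul]
      rw [Finset.sum_eq_single b (fun b' _ hb' => by rw [Pi.single_eq_of_ne (Ne.symm hb'), mul_zero])
        (fun h => absurd hb h)]
      simp
    have hv'0 : v' ≠ 0 := by
      intro h
      apply hvS
      have : v = ∑ b ∈ S, v b • (Pi.single b (1 : ℚ) : γ → ℚ) := by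
        rw [← sub_eq_zero]; exact h
      rw [this]
      exact Submodule.sum_mem _ fun b hb => Submodule.smul_mem _ _ (single_mem_coordSpan hb)
    obtain ⟨d, c, hd, hdc⟩ := exists_int_multiple v'
    have hcQ : castQ c = (d : ℚ) • v' := by funext b; simp [castQ, hdc b]
    have hcC : castQ c ∈ K.C := by rw [hcQ]; exact K.C.smul_mem _ hv'C
    have hcS : ∀ b ∈ S, c b = 0 := by
      intro b hb
      have := hdc b
      rw [hv'S b hb, mul_zero] at this
      exact_mod_cast this
    have hc0 : c ≠ 0 := by
      intro h
      apply hv'0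
      funext b
      have := hdc b
      rw [h] at this
      simp only [Pi.zero_apply, Int.cast_zero] at this
      have hd' : (d : ℚ) ≠ 0 := by exact_mod_cast hd
      exact (mul_eq_zero.mp this.symm).resolve_left hd'
    obtain ⟨κ', K', b₀, hb₀, hS', hrk', htr⟩ :=
      exists_split_step L (absSum c) κM K S c hS hcC hcS hc0 le_rfl
    refine htr (ih κ' K' (insert b₀ S) hS' ?_)
    rw [hrk', hrk, Finset.card_insert_of_notMem hb₀]
    ring

/-- **`exp⁻¹(G') = Lie G' + ker(exp)` is `Θ`-definable for EVERY connected algebraic subgroup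
datum of `M_κ`.** [cite: NesterenkoPhilippon2001, Ch. 11 Thm. 4.1 (the algebraic subgroups are cut out by forms)] -/
theorem thetaDefinable_preimageSubgroup (κM : δ → γ → Kbar) (K : SubgroupDataC β γ δ κM) :
    ThetaDefinable L κM (preimageSubgroup L κM K : Set (β ⊕ (γ ⊕ δ) → ℂ)) :=
  thetaDefinable_preimageSubgroup_aux L (finrank ℚ K.C) κM K ∅ (fun _ h => absurd h (Finset.notMem_empty _))
    (by simp)

/-! ### In a theta model: `Z(𝔍(Lie G')) ⊆ exp⁻¹(G')` -/

section Model

variable (κM : δ → γ → Kbar)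
variable {N : ℕ} (M : AnalyticGroupModel (β ⊕ (γ ⊕ δ) → ℂ) N) (e : Option β × ThetaIdx γ δ ≃ Fin (N + 1))
variable (hΘ : ∀ J w, M.Θ (e J) w = theta L κM J w)
include hΘ

/-- **The closure of the Lie algebra of a connected algebraic subgroup lies in its preimage**:
`Z(𝔍(Lie G')) ⊆ Lie G' + ker(exp)`, for every datum `K` (any number of elliptic factors; this
uses no hypothesis on complex multiplication). [cite: NesterenkoPhilippon2001, Ch. 11 Thm. 4.1] -/
theorem zeroSet_vanishing_tangent_subset_preimageSubgroup (K : SubgroupDataC β γ δ κM) :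
    M.zeroSet ((M.vanishing (K.tangent : Set (β ⊕ (γ ⊕ δ) → ℂ)) : Ideal _) :
        Set (MvPolynomial (Fin (N + 1)) ℂ)) ⊆ preimageSubgroup L κM K :=
  zeroSet_vanishing_subset_of_thetaDefinable L κM M e hΘ (thetaDefinable_preimageSubgroup L κM K)
    fun _ hw => AddSubgroup.mem_sup_left hw

end Model

end Std

end GaGmE

end Literature.NumberTheory.Transcendental

end
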